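import Literature.MathematicalPhysics.QuantumFieldTheory.Balaban1983to89.B8Prop3GaugeFixedKLevel
import Summits.QuantumFields.YangMills.Theorems.UnitScaleTiltHalvingP1FlatCoreWindowSizesOfSideTouches
import HarnessLib

/-!
# `hP1room` PROGRAMME (LEAD-H «H = hSupU» BOARD v2, RULING L-10 «[R-h] ⟸ ✓p642890 ∘ Prop 3 `msup` at `m = k` with (W1) H42-top — GO»):
# ★★★ THE [R-h] CALLER — [Balaban1985RegularSpaces] PROPOSITION 3 AT `k` LEVELS, APPLIED ONCE TO THE TOP GAUGE-FIXED FIELD, BOTH MEMBERS KEPT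
# ((1.62)₁ «`|A′| ≤ c⋆(Lʲη)⁻¹`» AND (1.62)₂ «`(Lʲη)²|∇^η_{U₀}A′| ≤ c⋆`»), THEN THE LEVEL-CUBE SIZES (hX1)∕(hX2) AND THE DOOR's `hsize`

Route `UnitScaleTilt`, crux K1 child «MinimiserStabilityRegPr» (stmt-QuantumFields-19200), registered stub `stub_halvingStep` (`BirthV10`), text
`hP1room ⟸ hSupU ⟸` the nine content rows of ✓p643656 `HalvingP1FlatCoreSupplierDoor.hSup_of_contentRows`; THIS FILE serves row [R-h] (`hX1`∕`hX2`).
Cell `ym3-torus` (HUMAN RULING D-0037: YM₃ on T³ is ladder rung R3 — NOT d = 4, NOT a mass gap, NOT the Clay problem), width seat `ym-ust-19200-w6` gen 2.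
`--supports stmt-QuantumFields-19200 --as helper`; THEOREMS ONLY (0 `def`, 0 `sorry`); count-neutral; nothing here claims `core′`, `hP1room`, `hSupU`, the stub, the crux or the gap.

WHAT.
* §1 (any `ℤᵈ`, `d ≥ 2`, C⋆-algebra `𝔸`) ★★★`prop3_sizes_top` — ✓`B8Prop3GaugeFixedKLevel.hP3_gaugeFixed_of_b9`'s one-page USE of Proposition 3 (n05-b's
  ✓`B8Prop3KLevel.prop3_norms_kLevel` at `α₂ := 2Lc⋆ + 8α₄`) REPLAYED AT THE SINGLE LEVEL `m = k` with the (1.42) clause `H42` and the (1.59) in-edge `H59` displayed AT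
  LEVEL `k` ONLY (the shape ★w8-19936 g3's (W1) `…TopH42` inhabits), and with Proposition 3's SECOND member KEPT (hP3 discards it): for the datum `(u, W, A)` with
  `W^{u} = U′`, (1.29), `Lan k W`, and the a priori chart row `W = e^{iηA}`, `‖A‖ ≤ (2Lc⋆+8α₄)(Lʲη)⁻¹` on the sides touching `Ω_j`, there is the masked exponent field
  `A′` (self-adjoint everywhere, `= A` on those sides) with `‖A‖ ≤ c⋆(Lʲη)⁻¹` there AND `(Lʲη)²‖∇^η_{U₀,κ}A′_τ(y)‖ ≤ c⋆` whenever `SideTouches (Ω j) y τ`.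
* §2 (same generality) ★★`levelCubeSizes_of_prop3_top` — §1 read on the LEVEL CUBES `□_j = cube L a M′ ρ′ k j ⊆ Ω j` at the FLAT background `U₀ = 1`:
  `(Lʲη)‖A z ν‖ ≤ c⋆` on `□_j` and `(Lʲη)²η⁻¹‖A (z+e_{ν′}) ν − A z ν‖ ≤ c⋆` for `z ∈ □_j`, `z + e_{ν′} ∈ □_0` (the mask is invisible there: both bonds touch some `Ω_j′`)
  — EXACTLY the (hX1)∕(hX2) letters of ✓`HalvingP1FlatCoreWindowSizes.hsize_of_windowSizes` (✓`HalvingP1FlatCoreWindowSizesOfSideTouches` §1 inside).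
* (companion file `…TopSizesMember`) ★★★`hsize_of_prop3_top` — the door's `hsize` block (✓p638875∕✓p640588, `B₁ε₀ := c⋆`) at the H-line member in ONE call.
HONEST SCOPE.  By-name instantiation; every analytic row stays DISPLAYED exactly as in N05's own files: (1.33)∕(1.34) `InAk` rows, the (1.42) clause `H42` (⟸ (W1)), the
(1.59) in-edge `H59` (= [4] Thm 3.3 for the gauge-fixed field), the windows of `prop3_norms_kLevel` at `α₂ = 2Lc⋆ + 8α₄`, and the a priori (1.41)-row of the datum
([R-h]-a: `eq184` + (1.108) + input sizes).  Nothing of Proposition 3 is re-proved (n05-b by name); nothing of `core′`, the stub or the crux.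

References: T. Bałaban, CMP **99** (1985) 75–102 [Balaban1985RegularSpaces] (Prop. 3 p.87, (1.62) p.87, (1.36) p.82, (1.40)–(1.42) p.83, Thm 4 p.88, p.86);
CMP **102** (1985) 277–309 [Balaban1985Variational] ((144) p.300, (152) p.301, p.286).
-/

set_option autoImplicit false

noncomputable section

open scoped BigOperators Matrix.Norms.L2Operator
open NormedSpace

namespace Summit.QuantumFields.YangMills.Theorems.HalvingP1FlatCoreTopSizes

open Literature.MathematicalPhysics.QuantumFieldTheory.Balaban1983to89
open Literature.MathematicalPhysics.QuantumFieldTheory.Balaban1983to89.T3ContinuumYM3Torus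
open Complex (I)
open MatrixLog B7Prop1Explicit B7Prop2Explicit B7Prop1Local B7Eq92Concrete
open B7Prop1Explicit renaming Site → LSite
open B8Lemma1NonAbelian (mulCfg)
open B8Ineq132 (covDerivFwd InAk BondTouches)
open B8Eq140Level (SideTouches)
open B8Eq119TwistedAxial (Restr129)
open B8Eq184Proof (gaugeExp cfgExp)
open B8Eq146AExpansion (iEta expCfg)
open B7Prop4GeneralLevels (logCovIter linCovIter)
open B8Eq155JBound (Jcur wsup)
open B8ScaledSupNorm (bondNorm msup weight Bdd)
open B7Prop3Flat (c3)
open B7Eq78Linearization (conjR)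
open B8Eq131Cubes (cube gs)
open B5Eq118OneStroke (iterBlockOf)
open B10Eq27TorusAxialLog (rel)
open B15Eq112TorusCover (lift)
open FlatCubeOpsText (IsLevWeight)
open FlatCubeSequenceAligned (cubeSeqMT3 cubeSetM)
open B8Prop3GaugeFixedKLevel (logField_spec mem_unitaryUnits_of_mgauge_eq mulCfg_eq_gaugeAct_of_mgauge_eq inAk_congr_of_sideTouches
  expCfg_iEta_eq_cfgExp cfgExp_congr_at)
open HalvingP1FlatCoreWindowSizesOfSideTouches (sideTouches_of_mem levelCubeSup_of_sideTouches levelCubeGrad_of_sideTouches)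
open HalvingP1FlatCoreWindowSizes (hsize_of_windowSizes)

variable {d : ℕ}

/-! ## §1 Proposition 3 at `k` levels for the top gauge-fixed field, both members -/

section Generic

variable {𝔸 : Type*} [CStarAlgebra 𝔸] [Nontrivial 𝔸]

/-- ★★★ **PROPOSITION 3 AT `k` LEVELS, APPLIED ONCE, BOTH MEMBERS** (✓`hP3_gaugeFixed_of_b9`'s replay at the single level `m = k`, second member kept): for a datum
`(u, W, A)` — `u` unitary-valued, `W^{u} = U′`, (1.29) `Restr129 L k (Λs k) U₀ u`, `Lan k W`, and on every side touching `Ω_j` (`j ≤ k`) the chart row `W = e^{iηA}` with the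
A PRIORI size `‖A‖ ≤ (2Lc⋆ + 8α₄)(Lʲη)⁻¹` — under (1.33)∕(1.34), the level-`k` (1.42) clause `H42` and (1.59) in-edge `H59` (per `(u, W, A′)`, as in N05), and the windows of
✓`prop3_norms_kLevel` at `α₂ = 2Lc⋆ + 8α₄`: the masked exponent field `A′ = (1∕iη) log W` on `⋃_{j ≤ k} SideTouches (Ω j)` (`0` off it) is self-adjoint everywhere, equals `A`
on those sides, and BOTH (1.62)₁ `‖A‖ ≤ c⋆(Lʲη)⁻¹` there AND (1.62)₂ `(Lʲη)²‖∇^η_{U₀,κ}A′_τ(y)‖ ≤ c⋆` for `SideTouches (Ω j) y τ` hold, `c⋆ = 5dLB₀(α₀ + α₁)`.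
[cite: Balaban1985RegularSpaces, Prop. 3 p.87, (1.62) p.87, (1.36) p.82, (1.40)-(1.42) p.83, Thm 4 p.88] -/
theorem prop3_sizes_top (hd2 : 2 ≤ d) {η : ℝ} (hη : 0 < η) {L : ℕ} (hL : 2 ≤ L) (k : ℕ)
    {U₀ U' : LSite d → Fin d → 𝔸ˣ} (hU₀ : ∀ x κ, U₀ x κ ∈ unitaryUnits 𝔸) (hU' : ∀ x κ, U' x κ ∈ unitaryUnits 𝔸)
    {α₀ α₁ α₄ B₀ cstar : ℝ} (hα₀ : 0 < α₀) (hα₁ : 0 ≤ α₁) (hα₄ : 0 ≤ α₄) (hB₀ : 0 ≤ B₀)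
    (hc : cstar = 5 * d * L * B₀ * (α₀ + α₁))
    (hα3 : C0 d * α₀ ≤ 1 / 3) (hα4 : 4 * α₀ ≤ c2' d L)
    (h16 : 16 * (2 * (L * cstar) + 8 * α₄) ≤ 1) (hd5 : 5 * (2 * (L * cstar) + 8 * α₄) * ((d : ℝ) - 1) ≤ 4)
    (hsmall : Real.exp (4 * (800 * ((d : ℝ) + 1) ^ 2 * ((d : ℝ) + 4)) * α₀)
      * (1 + 8 * (131072 * ((d : ℝ) + 1) ^ 2) * (2 * (L * cstar) + 8 * α₄)) ≤ 2)
    (hc₃ : 2 * (2 * (L * cstar) + 8 * α₄) ≤ c3 d L) (hside : 36 * d * B₀ * (2 * (L * cstar) + 8 * α₄) ≤ 1 / 2)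
    (h50 : 50 * d * (2 * (L * cstar) + 8 * α₄) ≤ 1)
    {C₂ : ℝ} (hC₂ : 8 * (131072 * ((d : ℝ) + 1) ^ 2) * Real.exp (4 * (800 * ((d : ℝ) + 1) ^ 2 * ((d : ℝ) + 4)) * α₀) ≤ C₂)
    (h61 : 2 * (2 * (L * cstar) + 8 * α₄) ^ 2 + 20 * d * α₀ * (2 * (L * cstar) + 8 * α₄)
      + 2 * C₂ * (2 * (L * cstar) + 8 * α₄) ^ 2 ≤ α₀ + α₁)
    (Ω : ℕ → Set (LSite d)) (Λs : ℕ → ℕ → Set (LSite d)) (Λb : ℕ → ℕ → Set (LSite d × Fin d))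
    (hbox : ∀ j, j ≤ k → ∀ c ∈ Λb k j, ∀ x, InBox (loK L j c.1) (bondHiK L j c.1 c.2) x → x ∈ Ω j)
    (h33 : InAk L k η α₀ Ω U₀) (h34 : InAk L k η α₀ Ω (mulCfg U' U₀))
    (Lan : ℕ → (LSite d → Fin d → 𝔸ˣ) → Prop)
    (H42 : ∀ (u : LSite d → 𝔸ˣ) (W : LSite d → Fin d → 𝔸ˣ) (A' : LSite d → Fin d → 𝔸),
      (∀ x, u x ∈ unitaryUnits 𝔸) → mgauge U₀ u W = U' → Restr129 L k (Λs k) U₀ u → Lan k W →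
      (∀ y τ, IsSelfAdjoint (A' y τ)) →
      (∀ j, j ≤ k → ∀ y τ, SideTouches (Ω j) y τ →
        W y τ = cfgExp η A' y τ ∧ ‖A' y τ‖ ≤ (2 * (L * cstar) + 8 * α₄) * ((L : ℝ) ^ j * η)⁻¹) →
      (∀ y τ, (∀ j, j ≤ k → ¬ SideTouches (Ω j) y τ) → A' y τ = 0) →
      ∀ j, j ≤ k → ∀ c ∈ Λb k j, ‖logCovIter L U₀ (iEta η A') j c.1 c.2‖ < 2 * d * L * α₁)
    (H59 : ∀ (u : LSite d → 𝔸ˣ) (W : LSite d → Fin d → 𝔸ˣ) (A' : LSite d → Fin d → 𝔸),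
      (∀ x, u x ∈ unitaryUnits 𝔸) → mgauge U₀ u W = U' → Restr129 L k (Λs k) U₀ u → Lan k W →
      (∀ y τ, IsSelfAdjoint (A' y τ)) →
      (∀ j, j ≤ k → ∀ y τ, SideTouches (Ω j) y τ →
        W y τ = cfgExp η A' y τ ∧ ‖A' y τ‖ ≤ (2 * (L * cstar) + 8 * α₄) * ((L : ℝ) ^ j * η)⁻¹) →
      (∀ y τ, (∀ j, j ≤ k → ¬ SideTouches (Ω j) y τ) → A' y τ = 0) →
      msup L k η (-(1 : ℝ)) (fun j (b : LSite d × Fin d) => SideTouches (Ω j) b.1 b.2) (fun b => A' b.1 b.2)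
          ≤ B₀ * (bondNorm L k η (-(3 : ℝ)) Ω (fun x μ => Jcur η U₀ A' μ x)
            + wsup 1 (fun p : {p : ℕ × (LSite d × Fin d) // p.1 ≤ k ∧ p.2 ∈ Λb k p.1} =>
                linCovIter L U₀ (iEta η A') p.1.1 p.1.2.1 p.1.2.2)) ∧
        msup L k η (-(2 : ℝ)) (fun j (t : Fin d × Fin d × LSite d) => SideTouches (Ω j) t.2.2 t.2.1)
            (fun t => covDerivFwd η U₀ t.1 (fun z => A' z t.2.1) t.2.2)
          ≤ B₀ * (bondNorm L k η (-(3 : ℝ)) Ω (fun x μ => Jcur η U₀ A' μ x)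
            + wsup 1 (fun p : {p : ℕ × (LSite d × Fin d) // p.1 ≤ k ∧ p.2 ∈ Λb k p.1} =>
                linCovIter L U₀ (iEta η A') p.1.1 p.1.2.1 p.1.2.2)))
    (u : LSite d → 𝔸ˣ) (W : LSite d → Fin d → 𝔸ˣ) (A : LSite d → Fin d → 𝔸)
    (hu : ∀ x, u x ∈ unitaryUnits 𝔸) (hW : mgauge U₀ u W = U') (h129 : Restr129 L k (Λs k) U₀ u) (hLan : Lan k W)
    (hWA : ∀ j, j ≤ k → ∀ y τ, SideTouches (Ω j) y τ →
      W y τ = cfgExp η A y τ ∧ ‖A y τ‖ ≤ (2 * (L * cstar) + 8 * α₄) * ((L : ℝ) ^ j * η)⁻¹) :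
    ∃ A' : LSite d → Fin d → 𝔸, (∀ y τ, IsSelfAdjoint (A' y τ)) ∧
      (∀ j, j ≤ k → ∀ y τ, SideTouches (Ω j) y τ → A' y τ = A y τ) ∧
      (∀ j, j ≤ k → ∀ y τ, SideTouches (Ω j) y τ → ‖A y τ‖ ≤ cstar * ((L : ℝ) ^ j * η)⁻¹) ∧
      (∀ j, j ≤ k → ∀ (y : LSite d) (κ τ : Fin d), SideTouches (Ω j) y τ →
        ((L : ℝ) ^ j * η) ^ 2 * ‖covDerivFwd η U₀ κ (fun z => A' z τ) y‖ ≤ cstar) := by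
  classical
  have hL1 : 1 ≤ L := le_trans (by norm_num) hL
  have hLr : (1 : ℝ) ≤ L := by exact_mod_cast hL1
  set α₂ : ℝ := 2 * (L * cstar) + 8 * α₄ with hα₂_def
  have hcstar : 0 ≤ cstar := by rw [hc]; positivity
  have hα₂ : 0 ≤ α₂ := by positivity
  have hα₂16 : α₂ ≤ 1 / 16 := by linarith
  -- `W` is unitary-valued
  have hWu : ∀ x κ, W x κ ∈ unitaryUnits 𝔸 := mem_unitaryUnits_of_mgauge_eq hU₀ hU' hu hW
  -- the bonds where the datum delivers `W = e^{iηA}`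
  set M : Set (LSite d × Fin d) := {b | ∃ j, j ≤ k ∧ SideTouches (Ω j) b.1 b.2} with hM_def
  -- the masked exponent field `A′ := (1/iη) log W` on `M`, `0` elsewhere
  set A' : LSite d → Fin d → 𝔸 :=
    fun y τ => M.indicator (fun b : LSite d × Fin d => η⁻¹ • ((I⁻¹ : ℂ) • mlog ((W b.1 b.2 : 𝔸ˣ) : 𝔸))) (y, τ) with hA'_def
  -- on a datum bond: `A′ = A`, self-adjoint, `W = e^{iηA′}`
  have hsock : ∀ j, j ≤ k → ∀ y τ, SideTouches (Ω j) y τ →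
      A' y τ = A y τ ∧ IsSelfAdjoint (A' y τ) ∧ W y τ = cfgExp η A' y τ := by
    intro j hj y τ hs
    have hmem : (y, τ) ∈ M := ⟨j, hj, hs⟩
    obtain ⟨hWA₁, hA₁⟩ := hWA j hj y τ hs
    have hLj : (1 : ℝ) ≤ (L : ℝ) ^ j := one_le_pow₀ hLr
    have hA₂ : ‖A y τ‖ ≤ α₂ * η⁻¹ := by
      calc ‖A y τ‖ ≤ α₂ * ((L : ℝ) ^ j * η)⁻¹ := hA₁
        _ = α₂ * η⁻¹ * ((L : ℝ) ^ j)⁻¹ := by rw [mul_inv]; ring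
        _ ≤ α₂ * η⁻¹ * 1 := by
            apply mul_le_mul_of_nonneg_left (inv_le_one_of_one_le₀ hLj) (by positivity)
        _ = α₂ * η⁻¹ := mul_one _
    obtain ⟨hlog, hsa, hexp⟩ := logField_spec hη U₀ hWu hWA₁ hA₂ hα₂16
    have hA'y : A' y τ = η⁻¹ • ((I⁻¹ : ℂ) • mlog ((W y τ : 𝔸ˣ) : 𝔸)) := by
      simp only [hA'_def, Set.indicator_of_mem hmem]
    refine ⟨by rw [hA'y, hlog], by rw [hA'y]; exact hsa, ?_⟩
    rw [hexp]
    exact cfgExp_congr_at η hA'y.symm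
  have hA'0 : ∀ y τ, (∀ j, j ≤ k → ¬ SideTouches (Ω j) y τ) → A' y τ = 0 := by
    intro y τ h
    have hnot : (y, τ) ∉ M := fun ⟨j, hj, hs⟩ => h j hj hs
    simp only [hA'_def, Set.indicator_of_notMem hnot]
  have hA'sa : ∀ y τ, IsSelfAdjoint (A' y τ) := by
    intro y τ
    by_cases hmem : (y, τ) ∈ M
    · obtain ⟨j, hj, hs⟩ := hmem
      exact (hsock j hj y τ hs).2.1
    · have : A' y τ = 0 := by simp only [hA'_def, Set.indicator_of_notMem hmem]
      rw [this]; exact IsSelfAdjoint.zero 𝔸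
  have hA'41 : ∀ j, j ≤ k → ∀ y τ, SideTouches (Ω j) y τ →
      W y τ = cfgExp η A' y τ ∧ ‖A' y τ‖ ≤ α₂ * ((L : ℝ) ^ j * η)⁻¹ := by
    intro j hj y τ hs
    obtain ⟨hAA, -, hWe⟩ := hsock j hj y τ hs
    exact ⟨hWe, by rw [hAA]; exact (hWA j hj y τ hs).2⟩
  -- global bound `‖A′‖ ≤ α₂η⁻¹`
  have hA'glob : ∀ y τ, ‖A' y τ‖ ≤ α₂ * η⁻¹ := by
    intro y τ
    by_cases hmem : (y, τ) ∈ M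
    · obtain ⟨j, hj, hs⟩ := hmem
      have hLj : (1 : ℝ) ≤ (L : ℝ) ^ j := one_le_pow₀ hLr
      calc ‖A' y τ‖ ≤ α₂ * ((L : ℝ) ^ j * η)⁻¹ := (hA'41 j hj y τ hs).2
        _ = α₂ * η⁻¹ * ((L : ℝ) ^ j)⁻¹ := by rw [mul_inv]; ring
        _ ≤ α₂ * η⁻¹ * 1 := by
            apply mul_le_mul_of_nonneg_left (inv_le_one_of_one_le₀ hLj) (by positivity)
        _ = α₂ * η⁻¹ := mul_one _
    · have : A' y τ = 0 := by simp only [hA'_def, Set.indicator_of_notMem hmem]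
      rw [this, norm_zero]; positivity
  -- the in-edge (1.59) and the (1.42) clause for `A′` at level `k`
  obtain ⟨h59a, h59g⟩ := H59 u W A' hu hW h129 hLan hA'sa hA'41 hA'0
  have h42 := H42 u W A' hu hW h129 hLan hA'sa hA'41 hA'0
  -- (1.40) for `U₀` and for `e^{iηA′}U₀`
  have h40W : InAk L k η α₀ Ω (mulCfg W U₀) := by
    have hui : ∀ x, u⁻¹ x ∈ U1 𝔸 := fun x => unitaryUnits_le_U1 ((unitaryUnits 𝔸).inv_mem (hu x))
    rw [mulCfg_eq_gaugeAct_of_mgauge_eq hW]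
    exact (B8Ineq132.inAk_gaugeAct_iff L k η α₀ Ω hui _).2 h34
  have h40₁ : InAk L k η α₀ Ω (mulCfg (expCfg (iEta η A')) U₀) := by
    refine (inAk_congr_of_sideTouches L k η α₀ (V := mulCfg W U₀) fun j hj y τ hs => ?_).1 h40W
    show W y τ * U₀ y τ = expCfg (iEta η A') y τ * U₀ y τ
    rw [(hA'41 j hj y τ hs).1, expCfg_iEta_eq_cfgExp]
  -- boundedness of the two weighted families and the gradient datum
  have hBa : Bdd L k η (-(1 : ℝ)) (fun j (b : LSite d × Fin d) => SideTouches (Ω j) b.1 b.2) fun b => A' b.1 b.2 := by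
    have e1 : (-(1 : ℝ)) = -((1 : ℕ) : ℝ) := by norm_num
    rw [e1]
    refine B8ScaledSupNorm.bdd_of_forall (c := α₂) fun j hj b hb => ?_
    have hs : 0 < (L : ℝ) ^ j * η := B8ScaledSupNorm.scale_pos hL1 hη j
    rw [B8ScaledSupNorm.weight_neg_natCast L η 1 j, pow_one]
    calc (L : ℝ) ^ j * η * ‖A' b.1 b.2‖ ≤ (L : ℝ) ^ j * η * (α₂ * ((L : ℝ) ^ j * η)⁻¹) :=
        mul_le_mul_of_nonneg_left (hA'41 j hj b.1 b.2 hb).2 hs.le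
      _ = α₂ := by field_simp
  have hU₀1 : ∀ x κ, U₀ x κ ∈ U1 𝔸 := fun x κ => unitaryUnits_le_U1 (hU₀ x κ)
  have hgrad : ∀ (y : LSite d) (κ τ : Fin d), ‖covDerivFwd η U₀ κ (fun z => A' z τ) y‖ ≤ 2 * α₂ * η⁻¹ * η⁻¹ := by
    intro y κ τ
    unfold covDerivFwd
    rw [norm_smul, norm_inv, Real.norm_eq_abs, abs_of_pos hη]
    have h1 : ‖conjR (U₀ y κ) (A' (y + e κ) τ) - A' y τ‖ ≤ α₂ * η⁻¹ + α₂ * η⁻¹ := by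
      calc ‖conjR (U₀ y κ) (A' (y + e κ) τ) - A' y τ‖
          ≤ ‖conjR (U₀ y κ) (A' (y + e κ) τ)‖ + ‖A' y τ‖ := norm_sub_le _ _
        _ ≤ α₂ * η⁻¹ + α₂ * η⁻¹ := by
            rw [B8Ineq132.norm_conjR (hU₀1 y κ)]
            exact add_le_add (hA'glob _ _) (hA'glob _ _)
    calc η⁻¹ * ‖conjR (U₀ y κ) (A' (y + e κ) τ) - A' y τ‖ ≤ η⁻¹ * (α₂ * η⁻¹ + α₂ * η⁻¹) :=
        mul_le_mul_of_nonneg_left h1 (by positivity)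
      _ = 2 * α₂ * η⁻¹ * η⁻¹ := by ring
  have hBg : Bdd L k η (-(2 : ℝ)) (fun j (t : Fin d × Fin d × LSite d) => SideTouches (Ω j) t.2.2 t.2.1)
      (fun t => covDerivFwd η U₀ t.1 (fun z => A' z t.2.1) t.2.2) := by
    have e2 : (-(2 : ℝ)) = -((2 : ℕ) : ℝ) := by norm_num
    rw [e2]
    refine B8ScaledSupNorm.bdd_of_forall (c := 2 * α₂ * ((L : ℝ) ^ k) ^ 2) fun j hj t _ => ?_
    rw [B8ScaledSupNorm.weight_neg_natCast L η 2 j]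
    have hLjm : (L : ℝ) ^ j ≤ (L : ℝ) ^ k := pow_le_pow_right₀ hLr hj
    have hLj0 : (0 : ℝ) ≤ (L : ℝ) ^ j := by positivity
    calc ((L : ℝ) ^ j * η) ^ 2 * ‖covDerivFwd η U₀ t.1 (fun z => A' z t.2.1) t.2.2‖
        ≤ ((L : ℝ) ^ j * η) ^ 2 * (2 * α₂ * η⁻¹ * η⁻¹) := mul_le_mul_of_nonneg_left (hgrad _ _ _) (by positivity)
      _ = 2 * α₂ * ((L : ℝ) ^ j) ^ 2 := by field_simp
      _ ≤ 2 * α₂ * ((L : ℝ) ^ k) ^ 2 := by gcongr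
  set g : ℝ := msup L k η (-(2 : ℝ)) (fun j (t : Fin d × Fin d × LSite d) => SideTouches (Ω j) t.2.2 t.2.1)
      (fun t => covDerivFwd η U₀ t.1 (fun z => A' z t.2.1) t.2.2) with hg_def
  have hg0 : 0 ≤ g := B8ScaledSupNorm.msup_nonneg L k hη.le _ _ _
  have hg : ∀ j, j ≤ k → ∀ (y : LSite d) (κ τ : Fin d), SideTouches (Ω j) y τ →
      ((L : ℝ) ^ j * η) ^ 2 * ‖covDerivFwd η U₀ κ (fun z => A' z τ) y‖ ≤ g := by
    intro j hj y κ τ hs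
    have h := B8ScaledSupNorm.weight_mul_norm_le_msup hBg hj (i := (κ, τ, y)) hs
    have hw : weight L η (-(2 : ℝ)) j = ((L : ℝ) ^ j * η) ^ 2 := by
      have e2 : (-(2 : ℝ)) = -((2 : ℕ) : ℝ) := by norm_num
      rw [e2, B8ScaledSupNorm.weight_neg_natCast L η 2 j]
    rw [hw] at h
    exact h
  -- PROPOSITION 3 at `k` levels for `A′` (n05-b's `prop3_norms_kLevel`), BOTH members kept
  obtain ⟨ha, hg', -, -⟩ := B8Prop3KLevel.prop3_norms_kLevel hd2 hη hL hU₀ hA'sa hα₀ hα₁ hα₂ hg0 hα3 hα4 h16 hd5 hsmall hc₃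
    hB₀ hside h50 hC₂ h61 hbox h33 h40₁ (fun j hj y τ hs => (hA'41 j hj y τ hs).2) hg h42 h59a h59g h59a h59a
  refine ⟨A', hA'sa, fun j hj y τ hs => (hsock j hj y τ hs).1, fun j hj y τ hs => ?_, fun j hj y κ τ hs => ?_⟩
  · -- (1.62)₁ pointwise on the side, back to `A`
    have hpt := B8ScaledSupNorm.norm_le_of_msup_le hL1 hη hBa ha hj (i := (y, τ)) hs
    rw [Real.rpow_neg_one] at hpt
    obtain ⟨hAA, -, -⟩ := hsock j hj y τ hs
    rw [← hAA, hc]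
    exact hpt
  · -- (1.62)₂ with the improved constant
    rw [hc]
    exact (hg j hj y κ τ hs).trans hg'

/-! ## §2 The level-cube reading at the flat background -/

/-- ★★ **THE LEVEL-CUBE SIZES (hX1)∕(hX2) FROM PROPOSITION 3 AT THE TOP, FLAT BACKGROUND `U₀ = 1`**: under §1's displayed inputs at `U₀ := 1` (so `U′` is the member's
field and `W = U′^{u⁻¹}`) and `□_j := cube L a M′ ρ′ k j ⊆ Ω j` (`j ≤ k`): `(Lʲη)·‖A z ν‖ ≤ c⋆` on `□_j`, and `(Lʲη)²·η⁻¹·‖A (z + e_{ν′}) ν − A z ν‖ ≤ c⋆` for `z ∈ □_j` with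
`z + e_{ν′} ∈ □_0` — the mask of §1 is invisible at both bonds (each touches some `Ω_j′`), `conjR 1 = id`.  These are EXACTLY the (hX1)∕(hX2) letters of
✓`HalvingP1FlatCoreWindowSizes.hsize_of_windowSizes` ∕ ✓p643656's `hX1 hX2`. [cite: Balaban1985RegularSpaces, Prop. 3 (1.62) p.87, (1.36) p.82, (1.131) p.99] -/
theorem levelCubeSizes_of_prop3_top (hd2 : 2 ≤ d) {η : ℝ} (hη : 0 < η) {L : ℕ} (hL : 2 ≤ L) (k : ℕ)
    {U' : LSite d → Fin d → 𝔸ˣ} (hU' : ∀ x κ, U' x κ ∈ unitaryUnits 𝔸)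
    {α₀ α₁ α₄ B₀ cstar : ℝ} (hα₀ : 0 < α₀) (hα₁ : 0 ≤ α₁) (hα₄ : 0 ≤ α₄) (hB₀ : 0 ≤ B₀)
    (hc : cstar = 5 * d * L * B₀ * (α₀ + α₁))
    (hα3 : C0 d * α₀ ≤ 1 / 3) (hα4 : 4 * α₀ ≤ c2' d L)
    (h16 : 16 * (2 * (L * cstar) + 8 * α₄) ≤ 1) (hd5 : 5 * (2 * (L * cstar) + 8 * α₄) * ((d : ℝ) - 1) ≤ 4)
    (hsmall : Real.exp (4 * (800 * ((d : ℝ) + 1) ^ 2 * ((d : ℝ) + 4)) * α₀)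
      * (1 + 8 * (131072 * ((d : ℝ) + 1) ^ 2) * (2 * (L * cstar) + 8 * α₄)) ≤ 2)
    (hc₃ : 2 * (2 * (L * cstar) + 8 * α₄) ≤ c3 d L) (hside : 36 * d * B₀ * (2 * (L * cstar) + 8 * α₄) ≤ 1 / 2)
    (h50 : 50 * d * (2 * (L * cstar) + 8 * α₄) ≤ 1)
    {C₂ : ℝ} (hC₂ : 8 * (131072 * ((d : ℝ) + 1) ^ 2) * Real.exp (4 * (800 * ((d : ℝ) + 1) ^ 2 * ((d : ℝ) + 4)) * α₀) ≤ C₂)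
    (h61 : 2 * (2 * (L * cstar) + 8 * α₄) ^ 2 + 20 * d * α₀ * (2 * (L * cstar) + 8 * α₄)
      + 2 * C₂ * (2 * (L * cstar) + 8 * α₄) ^ 2 ≤ α₀ + α₁)
    (Ω : ℕ → Set (LSite d)) (Λs : ℕ → ℕ → Set (LSite d)) (Λb : ℕ → ℕ → Set (LSite d × Fin d))
    (hbox : ∀ j, j ≤ k → ∀ c ∈ Λb k j, ∀ x, InBox (loK L j c.1) (bondHiK L j c.1 c.2) x → x ∈ Ω j)
    (h33 : InAk L k η α₀ Ω (1 : LSite d → Fin d → 𝔸ˣ)) (h34 : InAk L k η α₀ Ω (mulCfg U' (1 : LSite d → Fin d → 𝔸ˣ)))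
    (Lan : ℕ → (LSite d → Fin d → 𝔸ˣ) → Prop)
    (H42 : ∀ (u : LSite d → 𝔸ˣ) (W : LSite d → Fin d → 𝔸ˣ) (A' : LSite d → Fin d → 𝔸),
      (∀ x, u x ∈ unitaryUnits 𝔸) → mgauge (1 : LSite d → Fin d → 𝔸ˣ) u W = U' → Restr129 L k (Λs k) (1 : LSite d → Fin d → 𝔸ˣ) u → Lan k W →
      (∀ y τ, IsSelfAdjoint (A' y τ)) →
      (∀ j, j ≤ k → ∀ y τ, SideTouches (Ω j) y τ →
        W y τ = cfgExp η A' y τ ∧ ‖A' y τ‖ ≤ (2 * (L * cstar) + 8 * α₄) * ((L : ℝ) ^ j * η)⁻¹) →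
      (∀ y τ, (∀ j, j ≤ k → ¬ SideTouches (Ω j) y τ) → A' y τ = 0) →
      ∀ j, j ≤ k → ∀ c ∈ Λb k j, ‖logCovIter L (1 : LSite d → Fin d → 𝔸ˣ) (iEta η A') j c.1 c.2‖ < 2 * d * L * α₁)
    (H59 : ∀ (u : LSite d → 𝔸ˣ) (W : LSite d → Fin d → 𝔸ˣ) (A' : LSite d → Fin d → 𝔸),
      (∀ x, u x ∈ unitaryUnits 𝔸) → mgauge (1 : LSite d → Fin d → 𝔸ˣ) u W = U' → Restr129 L k (Λs k) (1 : LSite d → Fin d → 𝔸ˣ) u → Lan k W →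
      (∀ y τ, IsSelfAdjoint (A' y τ)) →
      (∀ j, j ≤ k → ∀ y τ, SideTouches (Ω j) y τ →
        W y τ = cfgExp η A' y τ ∧ ‖A' y τ‖ ≤ (2 * (L * cstar) + 8 * α₄) * ((L : ℝ) ^ j * η)⁻¹) →
      (∀ y τ, (∀ j, j ≤ k → ¬ SideTouches (Ω j) y τ) → A' y τ = 0) →
      msup L k η (-(1 : ℝ)) (fun j (b : LSite d × Fin d) => SideTouches (Ω j) b.1 b.2) (fun b => A' b.1 b.2)
          ≤ B₀ * (bondNorm L k η (-(3 : ℝ)) Ω (fun x μ => Jcur η (1 : LSite d → Fin d → 𝔸ˣ) A' μ x)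
            + wsup 1 (fun p : {p : ℕ × (LSite d × Fin d) // p.1 ≤ k ∧ p.2 ∈ Λb k p.1} =>
                linCovIter L (1 : LSite d → Fin d → 𝔸ˣ) (iEta η A') p.1.1 p.1.2.1 p.1.2.2)) ∧
        msup L k η (-(2 : ℝ)) (fun j (t : Fin d × Fin d × LSite d) => SideTouches (Ω j) t.2.2 t.2.1)
            (fun t => covDerivFwd η (1 : LSite d → Fin d → 𝔸ˣ) t.1 (fun z => A' z t.2.1) t.2.2)
          ≤ B₀ * (bondNorm L k η (-(3 : ℝ)) Ω (fun x μ => Jcur η (1 : LSite d → Fin d → 𝔸ˣ) A' μ x)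
            + wsup 1 (fun p : {p : ℕ × (LSite d × Fin d) // p.1 ≤ k ∧ p.2 ∈ Λb k p.1} =>
                linCovIter L (1 : LSite d → Fin d → 𝔸ˣ) (iEta η A') p.1.1 p.1.2.1 p.1.2.2)))
    (u : LSite d → 𝔸ˣ) (W : LSite d → Fin d → 𝔸ˣ) (A : LSite d → Fin d → 𝔸)
    (hu : ∀ x, u x ∈ unitaryUnits 𝔸) (hW : mgauge (1 : LSite d → Fin d → 𝔸ˣ) u W = U')
    (h129 : Restr129 L k (Λs k) (1 : LSite d → Fin d → 𝔸ˣ) u) (hLan : Lan k W)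
    (hWA : ∀ j, j ≤ k → ∀ y τ, SideTouches (Ω j) y τ →
      W y τ = cfgExp η A y τ ∧ ‖A y τ‖ ≤ (2 * (L * cstar) + 8 * α₄) * ((L : ℝ) ^ j * η)⁻¹)
    -- the level cubes inside the domains
    {a : LSite d} {M' ρ' : ℕ} (hΩ : ∀ j, j ≤ k → cube L a M' ρ' k j ⊆ Ω j) :
    (∀ j, j ≤ k → ∀ z ∈ cube L a M' ρ' k j, ∀ ν : Fin d, (L : ℝ) ^ j * η * ‖A z ν‖ ≤ cstar) ∧
    (∀ j, j ≤ k → ∀ z ∈ cube L a M' ρ' k j, ∀ ν ν' : Fin d, z + e ν' ∈ cube L a M' ρ' k 0 →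
      ((L : ℝ) ^ j * η) ^ 2 * η⁻¹ * ‖A (z + e ν') ν - A z ν‖ ≤ cstar) := by
  have hL1 : 1 ≤ L := le_trans (by norm_num) hL
  have hU₀ : ∀ (x : LSite d) (κ : Fin d), (1 : LSite d → Fin d → 𝔸ˣ) x κ ∈ unitaryUnits 𝔸 := fun _ _ => (unitaryUnits 𝔸).one_mem
  obtain ⟨A', -, hAA, hsup, hgrad⟩ := prop3_sizes_top hd2 hη hL k hU₀ hU' hα₀ hα₁ hα₄ hB₀ hc hα3 hα4 h16 hd5 hsmall hc₃ hside h50 hC₂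
    h61 Ω Λs Λb hbox h33 h34 Lan H42 H59 u W A hu hW h129 hLan hWA
  refine ⟨levelCubeSup_of_sideTouches hd2 hL1 hη Ω hΩ A hsup, fun j hj z hz ν ν' hz' => ?_⟩
  -- the gradient row for the masked field on the cubes, then back to `A` at both bonds
  have h := levelCubeGrad_of_sideTouches hd2 hη Ω hΩ A' (c := cstar) (fun j hj z ν ν' hs => hgrad j hj z ν' ν hs) j hj z hz ν ν'
  have h1 : A' z ν = A z ν := hAA j hj z ν (sideTouches_of_mem hd2 (hΩ j hj hz) ν)
  have h2 : A' (z + e ν') ν = A (z + e ν') ν := hAA 0 (Nat.zero_le k) (z + e ν') ν (sideTouches_of_mem hd2 (hΩ 0 (Nat.zero_le k) hz') ν)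
  rwa [h1, h2] at h

end Generic

end Summit.QuantumFields.YangMills.Theorems.HalvingP1FlatCoreTopSizes

end
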